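import Summits.KontsevichZagierPeriods.KontsevichZagierPeriods.Theorems.SoloInformedSectorPullback
import Summits.KontsevichZagierPeriods.KontsevichZagierPeriods.Theorems.SoloInformedLeafPackage
import Summits.KontsevichZagierPeriods.KontsevichZagierPeriods.Theorems.SoloInformedLeafTransport
import HarnessLib

/-!
# Corner configurations and their children

Solo programme `solo-KontsevichZagierPeriods-informed`, session s111, PRES-RAT(2) step (γ)-7.

A **corner configuration** `cfg(F, D, Ω)` on the unit square consists of an open
`ℚ`-semialgebraic `Ω ⊆ (0,1)²` whose frontier inside the open square lies on `{F = 0}`, such that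
every zero of `F` on `closure Ω ∩ [0,1]²` other than the corner `0` is a smooth point of
`{F = 0}` at which `D ≠ 0` (INV-B), and such that the singular set of `F` is finite.  The vertex
recursion proves `PresOn Ω (P/D)` for every configuration by induction on `μ♯(F, D)`; the corner
`0` is the only point where anything non-trivial happens.

This file proves the two structural facts about configurations used by the recursion:

* `soloInformed_cornerCfg_swap`: the swap `(x₀, x₁) ↦ (x₁, x₀)` of a configuration is one;
* `soloInformed_cornerCfg_child` (**a child of a configuration is a configuration**): for the
  sector map `Φ = Φ_{κ,t,λ}` with `0 < κ ≤ 1`, `λ ≠ 0`, `[t, t + λ] ⊆ [0, 1]` and no root of the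
  `m`-cone of `F` in the half-open slope interval `t + λ·(0, 1]`, the triple
  `(child F, X₀^e · child D, {x ∈ (0,1)² | Φ x ∈ Ω})` is a configuration.  The frontier
  condition and INV-B are transported through the local diffeomorphism `Φ` (gradient identities
  of `SoloInformedSectorPullback`); on the exceptional edge the child does not vanish by the
  choice of slopes; finiteness of the singular set is `soloInformed_singSet_childK_finite`.

References: this work (s110 `SoloInformedLocalSide`, s111 `SoloInformedSectorMap`,
`SoloInformedSectorPullback`).
-/

open scoped BigOperators Topology
open MeasureTheory Set Filter Metric
open Literature.NumberTheory.Transcendental Literature.NumberTheory.Transcendental.KZ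
open Literature.ModelTheory.ExponentialFields (IsSemialgebraic)

namespace Summit.KontsevichZagierPeriods.KontsevichZagierPeriods.Theorems

variable {K : Type*} [Field K] [Algebra K ℝ]

/-! ### Corner configurations -/

/-- **Corner configuration** `cfg(F, D, Ω)` at the corner `0` of the unit square. -/
structure SoloInformedCornerCfg (F D : MvPolynomial (Fin 2) K) (Ω : Set (Fin 2 → ℝ)) : Prop where
  isOpen : IsOpen Ω
  isSemialgebraic : IsSemialgebraic ℚ Ω
  subset : Ω ⊆ soloInformedOpenCube 2
  frontier : ∀ z ∈ soloInformedOpenCube 2, z ∈ frontier Ω → (MvPolynomial.aeval z F : ℝ) = 0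
  invB : ∀ z ∈ soloInformedCube 2, z ≠ 0 → z ∈ closure Ω → (MvPolynomial.aeval z F : ℝ) = 0 →
    ((MvPolynomial.aeval z (MvPolynomial.pderiv 0 F) : ℝ) ≠ 0 ∨
      (MvPolynomial.aeval z (MvPolynomial.pderiv 1 F) : ℝ) ≠ 0) ∧
    (MvPolynomial.aeval z D : ℝ) ≠ 0
  singFinite : (soloInformedSingSet F).Finite

/-- A configuration with `F = 0` has empty domain. -/
theorem SoloInformedCornerCfg.eq_empty_of_zero {D : MvPolynomial (Fin 2) K} {Ω : Set (Fin 2 → ℝ)}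
    (h : SoloInformedCornerCfg (0 : MvPolynomial (Fin 2) K) D Ω) : Ω = ∅ := by
  refine eq_empty_of_forall_notMem fun z hz => ?_
  have hz0 : z ≠ 0 := fun h0 => (lt_irrefl (0 : ℝ)) (by simpa [h0] using (h.subset hz 0).1)
  have := (h.invB z (soloInformedOpenCube_subset_cube _ (h.subset hz)) hz0 (subset_closure hz)
    (by simp)).1
  simp at this

/-! ### Swap symmetry -/

omit [Algebra K ℝ] in
/-- `∂₀` of the swapped polynomial. -/
theorem soloInformed_pderiv_zero_swapK (Q : MvPolynomial (Fin 2) K) :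
    MvPolynomial.pderiv 0 (soloInformedSwapK Q) = soloInformedSwapK (MvPolynomial.pderiv 1 Q) := by
  have h := soloInformed_pderiv_one_swapK (soloInformedSwapK Q)
  rw [soloInformed_swapK_swapK] at h
  rw [← soloInformed_swapK_swapK (MvPolynomial.pderiv 0 (soloInformedSwapK Q)), ← h]

/-- The singular set of the swapped polynomial. -/
theorem soloInformed_singSet_swapK (F : MvPolynomial (Fin 2) K) :
    soloInformedSingSet (soloInformedSwapK F) = Prod.swap ⁻¹' soloInformedSingSet F := by
  ext ⟨a, b⟩
  simp only [soloInformed_mem_singSet, soloInformed_evalR_apply, soloInformed_pderiv_zero_swapK,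
    soloInformed_pderiv_one_swapK, soloInformed_aeval_swapK, Matrix.cons_val_one,
    Matrix.cons_val_zero, mem_preimage, Prod.swap_prod_mk]
  tauto

/-- **Swap of a configuration.** -/
theorem soloInformed_cornerCfg_swap {F D : MvPolynomial (Fin 2) K} {Ω : Set (Fin 2 → ℝ)}
    (h : SoloInformedCornerCfg F D Ω) :
    SoloInformedCornerCfg (soloInformedSwapK F) (soloInformedSwapK D)
      ((fun z : Fin 2 → ℝ => (![z 1, z 0] : Fin 2 → ℝ)) ⁻¹' Ω) := by
  have hsa : IsSemialgebraic ℚ ((fun z : Fin 2 → ℝ => (![z 1, z 0] : Fin 2 → ℝ)) ⁻¹' Ω) := by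
    convert h.isSemialgebraic.preimage_comp (R := ℝ) (Equiv.swap (0 : Fin 2) 1) using 1
    ext z
    simp only [mem_preimage]
    have : (z ∘ (Equiv.swap (0 : Fin 2) 1)) = ![z 1, z 0] := by
      funext i; fin_cases i <;> rfl
    rw [this]
  have hcl : ∀ z : Fin 2 → ℝ, z ∈ closure ((fun z : Fin 2 → ℝ => (![z 1, z 0] : Fin 2 → ℝ)) ⁻¹' Ω)
      → (![z 1, z 0] : Fin 2 → ℝ) ∈ closure Ω := fun z hz =>
    soloInformed_continuous_swapPt.closure_preimage_subset Ω hz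
  refine ⟨soloInformed_continuous_swapPt.isOpen_preimage _ h.isOpen, hsa, fun z hz => ?_, ?_, ?_,
    ?_⟩
  · have hz' := h.subset hz
    have h0 : 0 < z 0 ∧ z 0 < 1 := by simpa using hz' 1
    have h1 : 0 < z 1 ∧ z 1 < 1 := by simpa using hz' 0
    intro j
    fin_cases j
    exacts [h0, h1]
  · intro z hz hfr
    rw [soloInformed_frontier_swap_preimage] at hfr
    rw [soloInformed_aeval_swapK]
    exact h.frontier _ (soloInformed_swap_mem_openCube hz) hfr
  · intro z hz hz0 hcz hF
    rw [soloInformed_aeval_swapK] at hF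
    have hz0' : (![z 1, z 0] : Fin 2 → ℝ) ≠ 0 := by
      intro h0
      apply hz0
      funext i
      fin_cases i
      · simpa using congr_fun h0 1
      · simpa using congr_fun h0 0
    obtain ⟨hg, hD⟩ := h.invB _ (soloInformed_swap_mem_cube hz) hz0' (hcl z hcz) hF
    refine ⟨?_, by rwa [soloInformed_aeval_swapK]⟩
    rw [soloInformed_pderiv_zero_swapK, soloInformed_pderiv_one_swapK, soloInformed_aeval_swapK,
      soloInformed_aeval_swapK]
    exact hg.symm
  · rw [soloInformed_singSet_swapK]
    exact h.singFinite.preimage Prod.swap_injective.injOn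

/-! ### Children of a configuration -/

/-- A child on the exceptional edge: `child(F)(0, y) = cone_F(t + λ y)`. -/
theorem soloInformed_aeval_childK_of_fst_eq_zero (F : MvPolynomial (Fin 2) K) (m : ℕ)
    (t κ lam : K) {z : Fin 2 → ℝ} (hz : z 0 = 0) :
    (MvPolynomial.aeval z (soloInformedChildK F m t κ lam) : ℝ) =
      Polynomial.aeval (algebraMap K ℝ t + algebraMap K ℝ lam * z 1) (soloInformedConePolyK F m)
      := by
  rw [soloInformed_aeval_childK, ← soloInformed_aeval_edge_blowLowK, hz, mul_zero]

/-- The slope bound along a sector map: `0 ≤ κ (t + λ y) ≤ 1` for `y ∈ [0, 1]` when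
`t, t + λ ≥ 0` and `κ t, κ (t + λ) ≤ 1`. -/
theorem soloInformed_sectorSlope_bounds {κ t lam y : ℝ} (ht0 : 0 ≤ t)
    (hs0 : 0 ≤ t + lam) (hkt : κ * t ≤ 1) (hks : κ * (t + lam) ≤ 1) (hy0 : 0 ≤ y) (hy1 : y ≤ 1) :
    0 ≤ t + lam * y ∧ κ * (t + lam * y) ≤ 1 := by
  refine ⟨by nlinarith, ?_⟩
  calc κ * (t + lam * y) = (1 - y) * (κ * t) + y * (κ * (t + lam)) := by ring
    _ ≤ (1 - y) * 1 + y * 1 :=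
        add_le_add (mul_le_mul_of_nonneg_left hkt (sub_nonneg.2 hy1))
          (mul_le_mul_of_nonneg_left hks hy0)
    _ = 1 := by ring

/-- Points of the closed square map into the closed square, for `0 < κ ≤ 1`, `t, t + λ ≥ 0` and
`κ t, κ (t + λ) ≤ 1`. -/
theorem soloInformed_sectorMap_mem_cube_of_slope {κ t lam : ℝ} (hκ0 : 0 < κ) (hκ1 : κ ≤ 1)
    (ht0 : 0 ≤ t) (hs0 : 0 ≤ t + lam) (hkt : κ * t ≤ 1) (hks : κ * (t + lam) ≤ 1) {z : Fin 2 → ℝ}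
    (hz : z ∈ soloInformedCube 2) :
    soloInformedSectorMap κ t lam z ∈ soloInformedCube 2 := by
  rw [soloInformed_mem_cube_iff] at hz ⊢
  have h0 := hz 0
  have h1 := hz 1
  obtain ⟨hsl0, hksl⟩ := soloInformed_sectorSlope_bounds ht0 hs0 hkt hks h1.1 h1.2
  have hk : κ * z 0 ≤ 1 := by nlinarith
  have hkz : 0 ≤ κ * z 0 := mul_nonneg hκ0.le h0.1
  have e0 : 0 ≤ soloInformedSectorMap κ t lam z 0 ∧ soloInformedSectorMap κ t lam z 0 ≤ 1 := by
    rw [soloInformedSectorMap_apply_zero]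
    exact ⟨hkz, hk⟩
  have e1 : 0 ≤ soloInformedSectorMap κ t lam z 1 ∧ soloInformedSectorMap κ t lam z 1 ≤ 1 := by
    rw [soloInformedSectorMap_apply_one]
    refine ⟨mul_nonneg hkz hsl0, ?_⟩
    calc κ * z 0 * (t + lam * z 1) = z 0 * (κ * (t + lam * z 1)) := by ring
      _ ≤ 1 * 1 := mul_le_mul h0.2 hksl (mul_nonneg hκ0.le hsl0) zero_le_one
      _ = 1 := one_mul 1
  intro j
  fin_cases j
  exacts [e0, e1]

/-- Points of the open square map into the open square, for `0 < κ ≤ 1`, `λ ≠ 0`,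
`t, t + λ ≥ 0` and `κ t, κ (t + λ) ≤ 1`. -/
theorem soloInformed_sectorMap_mem_openCube_of_slope {κ t lam : ℝ} (hκ0 : 0 < κ) (hκ1 : κ ≤ 1)
    (hlam : lam ≠ 0) (ht0 : 0 ≤ t) (hs0 : 0 ≤ t + lam) (hkt : κ * t ≤ 1) (hks : κ * (t + lam) ≤ 1)
    {z : Fin 2 → ℝ} (hz : z ∈ soloInformedOpenCube 2) :
    soloInformedSectorMap κ t lam z ∈ soloInformedOpenCube 2 := by
  have h0 := hz 0
  have h1 := hz 1
  have hsl0 : 0 < t + lam * z 1 := by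
    rcases lt_or_gt_of_ne hlam with hl | hl
    · nlinarith
    · nlinarith
  have hksl := (soloInformed_sectorSlope_bounds ht0 hs0 hkt hks h1.1.le h1.2.le).2
  have hk : κ * z 0 < 1 := by nlinarith
  have hkz : 0 < κ * z 0 := mul_pos hκ0 h0.1
  have e0 : 0 < soloInformedSectorMap κ t lam z 0 ∧ soloInformedSectorMap κ t lam z 0 < 1 := by
    rw [soloInformedSectorMap_apply_zero]
    exact ⟨hkz, hk⟩
  have e1 : 0 < soloInformedSectorMap κ t lam z 1 ∧ soloInformedSectorMap κ t lam z 1 < 1 := by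
    rw [soloInformedSectorMap_apply_one]
    refine ⟨mul_pos hkz hsl0, ?_⟩
    calc κ * z 0 * (t + lam * z 1) = z 0 * (κ * (t + lam * z 1)) := by ring
      _ < 1 * (κ * (t + lam * z 1)) := mul_lt_mul_of_pos_right h0.2 (mul_pos hκ0 hsl0)
      _ ≤ 1 := by rw [one_mul]; exact hksl
  intro j
  fin_cases j
  exacts [e0, e1]

/-- Points of the closed square off the edge `x₀ = 0` map into the closed square minus the
corner, for `0 < κ ≤ 1` and `[t, t + λ] ⊆ [0, 1]`. -/
theorem soloInformed_sectorMap_mem_cube {κ t lam : ℝ} (hκ0 : 0 < κ) (hκ1 : κ ≤ 1) (ht0 : 0 ≤ t)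
    (ht1 : t ≤ 1) (hs0 : 0 ≤ t + lam) (hs1 : t + lam ≤ 1) {z : Fin 2 → ℝ}
    (hz : z ∈ soloInformedCube 2) :
    soloInformedSectorMap κ t lam z ∈ soloInformedCube 2 :=
  soloInformed_sectorMap_mem_cube_of_slope hκ0 hκ1 ht0 hs0 (by nlinarith) (by nlinarith) hz

/-- Points of the open square map into the open square, for `0 < κ ≤ 1` and
`[t, t + λ] ⊆ [0, 1]`, `λ ≠ 0`. -/
theorem soloInformed_sectorMap_mem_openCube {κ t lam : ℝ} (hκ0 : 0 < κ) (hκ1 : κ ≤ 1)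
    (hlam : lam ≠ 0) (ht0 : 0 ≤ t) (ht1 : t ≤ 1) (hs0 : 0 ≤ t + lam) (hs1 : t + lam ≤ 1)
    {z : Fin 2 → ℝ} (hz : z ∈ soloInformedOpenCube 2) :
    soloInformedSectorMap κ t lam z ∈ soloInformedOpenCube 2 :=
  soloInformed_sectorMap_mem_openCube_of_slope hκ0 hκ1 hlam ht0 hs0 (by nlinarith) (by nlinarith) hz

/-- **A child of a configuration is a configuration** (sectors of slopes `t, t + λ ≥ 0` with
`κ t, κ (t + λ) ≤ 1`). -/
theorem soloInformed_cornerCfg_child_of_slope {F D : MvPolynomial (Fin 2) K}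
    {Ω : Set (Fin 2 → ℝ)}
    (hK : ∀ c : K, IsAlgebraic ℚ (algebraMap K ℝ c)) (h : SoloInformedCornerCfg F D Ω)
    {m d : ℕ} (hm : ∀ a ∈ F.support, m ≤ a 0 + a 1) (hcone : soloInformedConePolyK F m ≠ 0)
    (hd : ∀ a ∈ D.support, d ≤ a 0 + a 1) {t κ lam : K} (hκ0 : 0 < algebraMap K ℝ κ)
    (hκ1 : algebraMap K ℝ κ ≤ 1) (hlam : algebraMap K ℝ lam ≠ 0) (ht0 : 0 ≤ algebraMap K ℝ t)
    (hs0 : 0 ≤ algebraMap K ℝ t + algebraMap K ℝ lam) (hkt : algebraMap K ℝ κ * algebraMap K ℝ t ≤ 1)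
    (hks : algebraMap K ℝ κ * (algebraMap K ℝ t + algebraMap K ℝ lam) ≤ 1)
    (hroot : ∀ y : ℝ, 0 < y → y ≤ 1 →
      Polynomial.aeval (algebraMap K ℝ t + algebraMap K ℝ lam * y) (soloInformedConePolyK F m) ≠ 0)
    (e : ℕ) :
    SoloInformedCornerCfg (soloInformedChildK F m t κ lam)
      (MvPolynomial.X 0 ^ e * soloInformedChildK D d t κ lam)
      {x | x ∈ soloInformedOpenCube 2 ∧
        soloInformedSectorMap (algebraMap K ℝ κ) (algebraMap K ℝ t) (algebraMap K ℝ lam) x ∈ Ω}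
      := by
  set Φ := soloInformedSectorMap (algebraMap K ℝ κ) (algebraMap K ℝ t) (algebraMap K ℝ lam)
    with hΦ
  have hΦc : Continuous Φ :=
    continuous_iff_continuousAt.2 fun x => (soloInformed_hasFDerivAt_sectorMap _ _ _ x).continuousAt
  have hκne : algebraMap K ℝ κ ≠ 0 := hκ0.ne'
  refine ⟨(soloInformed_isOpen_openCube 2).inter (hΦc.isOpen_preimage _ h.isOpen),
    soloInformed_isSemialgebraic_sep_sectorMap_mem hK (isSemialgebraic_soloInformedOpenCube 2) κ t
      lam h.isSemialgebraic, fun x hx => hx.1, ?_, ?_,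
    soloInformed_singSet_childK_finite F hm hcone hκne hlam h.singFinite⟩
  · -- the frontier condition
    intro z hz hfr
    have hfr' : z ∈ frontier (Φ ⁻¹' Ω) := by
      rcases frontier_inter_subset (soloInformedOpenCube 2) (Φ ⁻¹' Ω) hfr with ⟨hA, -⟩ | ⟨-, hB⟩
      · exact (hA.2 (by rwa [(soloInformed_isOpen_openCube 2).interior_eq])).elim
      · exact hB
    have hΦz : Φ z ∈ frontier Ω := hΦc.frontier_preimage_subset Ω hfr'
    have hzo : Φ z ∈ soloInformedOpenCube 2 :=
      soloInformed_sectorMap_mem_openCube_of_slope hκ0 hκ1 hlam ht0 hs0 hkt hks hz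
    have hF := h.frontier _ hzo hΦz
    rw [hΦ, soloInformed_aeval_sectorMap F hm] at hF
    exact (mul_eq_zero.1 hF).resolve_left (pow_ne_zero _ (mul_ne_zero hκne (hz 0).1.ne'))
  · -- INV-B
    intro z hz hz0 hcz hFz
    have hzc := (soloInformed_mem_cube_iff.1 hz)
    by_cases hz00 : z 0 = 0
    · exfalso
      rw [soloInformed_aeval_childK_of_fst_eq_zero F m t κ lam hz00] at hFz
      have hz1 : z 1 ≠ 0 := by
        intro hz1
        apply hz0
        funext i
        fin_cases i
        · exact hz00
        · exact hz1
      exact hroot (z 1) (lt_of_le_of_ne (hzc 1).1 (Ne.symm hz1)) (hzc 1).2 hFz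
    · have hΦcube : Φ z ∈ soloInformedCube 2 :=
        soloInformed_sectorMap_mem_cube_of_slope hκ0 hκ1 ht0 hs0 hkt hks hz
      have hΦne : Φ z ≠ 0 := fun h0 => by
        have := congr_fun h0 0
        rw [hΦ, soloInformedSectorMap_apply_zero, Pi.zero_apply] at this
        exact mul_ne_zero hκne hz00 this
      have hΦcl : Φ z ∈ closure Ω :=
        hΦc.closure_preimage_subset Ω (closure_mono (fun x hx => hx.2) hcz)
      have hFΦ : (MvPolynomial.aeval (Φ z) F : ℝ) = 0 := by
        rw [hΦ, soloInformed_aeval_sectorMap F hm, hFz, mul_zero]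
      obtain ⟨hg, hD⟩ := h.invB _ hΦcube hΦne hΦcl hFΦ
      refine ⟨soloInformed_grad_childK_ne_zero F hm hκne hlam hz00 hFz hg, ?_⟩
      rw [map_mul, map_pow, MvPolynomial.aeval_X]
      refine mul_ne_zero (pow_ne_zero _ hz00) fun hDz => hD ?_
      rw [hΦ, soloInformed_aeval_sectorMap D hd, hDz, mul_zero]

/-- **A child of a configuration is a configuration.** -/
theorem soloInformed_cornerCfg_child {F D : MvPolynomial (Fin 2) K} {Ω : Set (Fin 2 → ℝ)}
    (hK : ∀ c : K, IsAlgebraic ℚ (algebraMap K ℝ c)) (h : SoloInformedCornerCfg F D Ω)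
    {m d : ℕ} (hm : ∀ a ∈ F.support, m ≤ a 0 + a 1) (hcone : soloInformedConePolyK F m ≠ 0)
    (hd : ∀ a ∈ D.support, d ≤ a 0 + a 1) {t κ lam : K} (hκ0 : 0 < algebraMap K ℝ κ)
    (hκ1 : algebraMap K ℝ κ ≤ 1) (hlam : algebraMap K ℝ lam ≠ 0) (ht0 : 0 ≤ algebraMap K ℝ t)
    (ht1 : algebraMap K ℝ t ≤ 1) (hs0 : 0 ≤ algebraMap K ℝ t + algebraMap K ℝ lam)
    (hs1 : algebraMap K ℝ t + algebraMap K ℝ lam ≤ 1)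
    (hroot : ∀ y : ℝ, 0 < y → y ≤ 1 →
      Polynomial.aeval (algebraMap K ℝ t + algebraMap K ℝ lam * y) (soloInformedConePolyK F m) ≠ 0)
    (e : ℕ) :
    SoloInformedCornerCfg (soloInformedChildK F m t κ lam)
      (MvPolynomial.X 0 ^ e * soloInformedChildK D d t κ lam)
      {x | x ∈ soloInformedOpenCube 2 ∧
        soloInformedSectorMap (algebraMap K ℝ κ) (algebraMap K ℝ t) (algebraMap K ℝ lam) x ∈ Ω}
      :=
  soloInformed_cornerCfg_child_of_slope hK h hm hcone hd hκ0 hκ1 hlam ht0 hs0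
    (by nlinarith) (by nlinarith) hroot e

end Summit.KontsevichZagierPeriods.KontsevichZagierPeriods.Theorems
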